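import Mathlib
import Summits.ResolutionOfSingularities.ResolutionOfSingularities.Theorems.WeightedInvariantLocalWeightedDropTOT2CurveConflictConverse
import Summits.ResolutionOfSingularities.ResolutionOfSingularities.Theorems.WeightedInvariantLocalWeightedDropPolyDescentCompare

/-!
# `LocalWeightedDrop`, TOT2-LINE regime (P), piece (P3) transport table — CONVERSE OF (F3): no new `u₁`-graphs at a translated `u₁`-chart point

Crux item stmt-ResolutionOfSingularities-8899 `WeightedInvariant.LocalWeightedDrop` (route `ResolutionOfSingularities/WeightedInvariant`), ENGINE
skeleton v34 (80c4710965b6845c), registered stub `stub_regimePresented`, piece (P3) (res-type-088's conflict budget: CONVERSE laws of the transport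
table, S-CRV-D-DESIGN.md ADDENDUM v2.5 «remaining converses: translated chart, …»).  [OURS · L1 W4.3 · chain w43 · seat res-L1-w43-stub-1 gen 6;
def-free; composes res-type-088's u₁-chart-origin converse `TOT2Curve.graph_of_blowOneT_origin` (…TOT2CurveConflictConverse p549387) with (F2)
`isPermissibleTwoT_graph_recentre` backwards and the split shear `shearT_C_add_X_mul`; nothing here is a statement of any manuscript; AI-produced,
gate-checked, weaker than expert review.]

* **`graph_of_blowOneT_translate`** — if the successor `blowOneT d (shift d (shearT (C λ) A) ψ₀)` (succT's translated `u₁`-chart point `λ`,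
  `ψ₀(0) = 0`, the re-centred linearly sheared label a position) carries a permissible graph curve with `u₂`-free datum `h₁`, then `A` carries a
  permissible graph curve with datum `λ + u₁h₁` — the converse of (F3) `graph_blowOneT_translate` (p533302);
* `hasGraphCurveT_of_blowOneT_translate` — predicate form.
-/

set_option linter.dupNamespace false -- mandated namespace of this single-conjunct summit

noncomputable section

namespace Summit.ResolutionOfSingularities.ResolutionOfSingularities.Theorems

namespace TOT2Curve

open MvPowerSeries PolyDescent MonicDescent WildMonic Literature.AlgebraicGeometry.Resolution

variable {k : Type} [Field k] {d : ℕ}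

/-- **CONVERSE OF (F3) — NO NEW `u₁`-GRAPHS AT A TRANSLATED `u₁`-CHART POINT.**  Let `ψ₀(0) = 0` make the linearly sheared label
`shearT (C λ) A` a position after re-centring.  If the `u₁`-chart of that position carries a permissible graph curve with `u₂`-free datum `h₁`,
then `A` carries a permissible graph curve with datum `λ + u₁·h₁`. -/
theorem graph_of_blowOneT_translate (A : Fin d → MvPowerSeries (Fin 2) k) (la : k) (h₁ ψ' ψ₀ : MvPowerSeries (Fin 2) k)
    (hh₁ : ∀ e : Fin 2 →₀ ℕ, e 1 ≠ 0 → coeff e h₁ = 0) (hψ₀ : constantCoeff ψ₀ = 0) (hpos : IsPosT d (shift d (shearT (C la) A) ψ₀))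
    (hperm' : IsPermissibleTwoT d (shift d (shearT h₁ (blowOneT d (shift d (shearT (C la) A) ψ₀))) ψ')) :
    ∃ ψ : MvPowerSeries (Fin 2) k, constantCoeff ψ = 0 ∧ IsPermissibleTwoT d (shift d (shearT (C la + X 0 * h₁) A) ψ) := by
  -- the `u₁`-chart origin converse at the position `shift d (shearT (C λ) A) ψ₀`
  obtain ⟨ψ₁, hψ₁, hperm₁⟩ := graph_of_blowOneT_origin _ hpos h₁ ψ' hh₁ hperm'
  -- undo the re-centring `ψ₀` ((F2) with `−ψ₀`) and recombine the shear
  have h2 := isPermissibleTwoT_graph_recentre (X 0 * h₁) (shift d (shearT (C la) A) ψ₀) ψ₁ (-ψ₀) hperm₁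
  rw [shift_shift_neg, ← shearT_C_add_X_mul] at h2
  refine ⟨ψ₁ - shear (X 0 * h₁) (-ψ₀), ?_, h2⟩
  rw [map_sub, hψ₁, constantCoeff_shear_eq_zero _ _ (by rw [map_neg, hψ₀, neg_zero]), sub_zero]

/-- Predicate form: a graph curve of the translated `u₁`-chart successor comes from a graph curve of `A`. -/
theorem hasGraphCurveT_of_blowOneT_translate (A : Fin d → MvPowerSeries (Fin 2) k) (la : k) (ψ₀ : MvPowerSeries (Fin 2) k)
    (hψ₀ : constantCoeff ψ₀ = 0) (hpos : IsPosT d (shift d (shearT (C la) A) ψ₀))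
    (hG : HasGraphCurveT d (blowOneT d (shift d (shearT (C la) A) ψ₀))) : HasGraphCurveT d A := by
  obtain ⟨h₁, ψ', hh₁, -, hperm'⟩ := hG
  obtain ⟨ψ, hψ, hperm⟩ := graph_of_blowOneT_translate A la h₁ ψ' ψ₀ hh₁ hψ₀ hpos hperm'
  refine ⟨C la + X 0 * h₁, ψ, fun e he => ?_, hψ, hperm⟩
  rw [map_add, coeff_C, if_neg (fun h0 => he (by rw [h0]; rfl)), zero_add, X, coeff_monomial_mul]
  split_ifs with hle
  · rw [one_mul]
    apply hh₁
    simpa using he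
  · rfl

end TOT2Curve

end Summit.ResolutionOfSingularities.ResolutionOfSingularities.Theorems

end
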